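import Literature.MathematicalPhysics.QuantumFieldTheory.Balaban1983to89.B9Eq3117Polarized
import Literature.MathematicalPhysics.QuantumFieldTheory.Balaban1983to89.B9Eq310DeltaPrimeJunction
import Literature.MathematicalPhysics.QuantumFieldTheory.Balaban1983to89.B9Eq3119DeltaPiCarrier

/-!
# `Balaban1983to89.B9Eq3117HessOpGaugeMode` — T. Bałaban, *Propagators for lattice gauge theories in a background field*, Commun. Math. Phys. **99**
# (1985) 389–434 [Balaban1985BackgroundPropagators] (3.117) p. 419 — «⟨A − Dλ, Δ(A − Dλ)⟩ = ⟨A, ΔA⟩ − ⟨i[λ(b₋), A(b)] − i[A(b), R_bλ(b₊)] − i[λ(b₋),(Dλ)(b)], J⟩.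
# The last equality can be interpreted as almost invariance of the quadratic form, the error terms are small because the function J = D*η⁻²Im ∂U is
# small, if U satisfies the condition (3.36)» — READ AS AN OPERATOR IDENTITY ON THE pub-balaban NE9 CHAIN's `L²` BOND CARRIER:
# **THE HESSIAN `Δ^η(U)` OF (3.10) APPLIED TO A PURE GAUGE MODE `D^η_Uλ` IS THE CURRENT COMMUTATOR `(Δ^η(U)D^η_Uλ)(b) = (i∕2)[J(b), λ(b₋) + R(U_b)λ(b₊)]`
# — ORDER ZERO IN `λ`, NO `η⁻¹`** (the `curl_U†(F·λ)` part of `D*D(D_Uλ)` and the curvature part `Δ′(D_Uλ)` recombine into the commutator with the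
# DIVERGENCE of the field strength; continuum shadow `Hess_A(d_Aλ) = [d_A*F_A, λ]`), with its pointwise letter `‖(Δ^η(U)D^η_Uλ)(b)‖ ≤ M_φ′j₀M_φ(‖λ(b₋)‖ + ‖λ(b₊)‖)`
# under print's third window (3.36) in the shape `‖J(b)‖ ≤ j₀`

statement-level skeleton of published theorems with citation tags; proofs where landed; nothing here is a claim about the Yang–Mills mass gap

CITATION HEADER (lean-in-tree rule).  Audit cell `pub-balaban`, sub-cell `t4`, BINDER row NE9; filed by the NE9 BINDER-row OWNER lineage `b2b-balaban-t4-ne9-p1`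
(gen 97) as the stone (S1) of its plan v14∕v15 (journal `HOME/CLAIMS.log` A-3 l.65765, E-2 l.65766, R-ne9p1-g97-1; ne9-leaf-05 g88 CONSULT C-leaf05-g88-1 l.65943
reached the same reading independently).  Source READ first-hand this generation in the held text layer (`paper:balaban1985-cmp99-background-propagators`, journal
page = PDF page + 388): p. 392 (3.10)–(3.11), p. 396 (3.35)–(3.36), p. 419 (3.117)–(3.120), pp. 421–422 (3.130)–(3.131).  COMPOSED BY NAME, nothing restated:
lit-balaban r06's kernel-checked (3.117) `B9Eq3117Polarized.two_mul_bondPair_deltaOp_covDη` (the `(A, λ)`-bilinear part of (3.117) on the abstract shift model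
of `B9Eq39Adjoint`), ne9-leaf-04's junction `B9Eq310DeltaPrimeJunction.hessForm_self_eq_hessPair` (the dictionary `T μ := shiftEquiv μ`, `U μ x := U (x, μ)`),
this lineage's `B9Eq310DeltaPrime.hessForm`, `B9Eq310HessianOperator.hessOp = principalOpK + curvOp`, ne9-leaf-05's bilinear trace pairing `B9Eq311TracePairing.tpair`
and `B9Eq3119DeltaPiCarrier.apply_equiv_covCurlL2K`∕`covCurlL2K_starW`, lit-balaban's `B9Eq310Hermitian.hessPair_add`, `B9Eq310HessianHermitian.adTransportW_adjoint`.

WHAT IS PROVED (sorry-free; proof lane — 0 `def`; [folklore] algebra over the located printed identity).  Carrier: the periodic lattice `TSite d Pd` of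
`B9SectCLatticeCarrier` (so EVERY tower `towerP L m (n+1)` verbatim), `BondL2K ℂ d Pd c₀ W` ∕ `SiteL2K ℂ d Pd c₀ W` with fibre `W ≃ₗ[ℂ] 𝔸` along `φ`, a linear
`τ : 𝔸 → ℂ`, background `U : Bond → 𝔸ˣ`; MODEL letters as in the chain's rows — `hτ₂` (tracial `τ`), `hφ` (norming `⟨φ⁻¹X, φ⁻¹Y⟩ = τ(X*Y)`), `hU` (`U(b)* = U(b)⁻¹`),
`η ≠ 0`, and — NEW, LOAD-BEARING — **`hc₀ : c₀ = η^d`** (print's weight (3.11)).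
* §1 `hessForm_symm` (tracial `τ`); **`hessForm_eq_bondPair_deltaOp`** — THE POLAR HESSIAN JUNCTION: `hessForm τ η U A B = bondPair η d τ Â (deltaOp T U η B̂)` for ALL
  `A, B` (the diagonal junction at `A + B`, symmetry, `hessPair_add`, `2 ≠ 0`).
* §2 `toAlg_covDerivL2K` — the dictionary for the covariant gradient of a SITE function: `φ((D^η_Uλ)(x,μ)) = covDη T U η (φ∘λ) μ x` (definitional up to `R(U)X = UXU⁻¹`).
* §3 `tpair_principalOpK_eq`, `tpair_curvOp_eq`, **`tpair_hessOp_eq`** — at `c₀ = η^d`: `tpair φ τ x (hessOp φ η U τ y) = hessForm τ η U (toAlg φ x) (toAlg φ y)` (the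
  operator's BILINEAR form IS print's polarized (3.10); `c₀ = η^d` is where the principal block, weighted by `c₀` through `⟨D x, D y⟩_plaq`, and the curvature
  block, the Riesz representative of `curvForm` with its built-in `η^d`, carry the SAME weight).
* §4 **`equiv_hessOp_covDerivL2K`** — THE OPERATOR FORM OF (3.117): for every site function `l` and bond `b = ⟨x, x + e_μ⟩`,
  `WL2.equiv (hessOp φ η U τ (covDerivL2K ℂ c₀ η⁻¹ (adTransportW φ U) l)) b = φ⁻¹((i∕2)·(J(b)·M(b) − M(b)·J(b)))`, `M(b) = φ(l(x)) + U(b)·φ(l(x+e_μ))·U(b)⁻¹`,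
  `J = B9Eq39Adjoint.J (shiftEquiv ·) (U(·,·)) η` the current (3.11) through the dictionary; proof: test against every `z` through `tpair` (non-degenerate:
  `tpair (starW z) · = ⟪z, ·⟫`), §3, §1, §2, r06's identity with `τ` promoted to a continuous functional (`𝔸` is finite-dimensional along `φ`), and the trace
  bookkeeping `τ((i[λ,A] − i[A,Rλ′])J) = τ(A·i[J, λ + Rλ′])`.
* §5 **`norm_equiv_hessOp_covDerivL2K_le`** — `‖(Δ^η(U)D^η_Uλ)(b)‖ ≤ M_φ′·j₀·M_φ·(‖λ(b₋)‖ + ‖λ(b₊)‖)` under `U(b) ∈ U1`, `‖φw‖ ≤ M_φ‖w‖`, `‖φ⁻¹X‖ ≤ M_φ′‖X‖`, and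
  print's (3.36) in the shape **`hJ : ‖J(b)‖ ≤ j₀`** («the error terms are small because the function J is small»); `_le_sup` (`≤ 2M_φM_φ′j₀N` for `‖λ‖ ≤ N`);
  `equiv_hessOp_covDerivL2K_eq_zero` (the output at `b` vanishes unless `λ(b₋) ≠ 0` or `λ(b₊) ≠ 0`: a one-step stencil — the (L)-letter `(L)(Δ∘D_U; 2M_φM_φ′j₀e^{κ}, κ)`
  for every `κ` is immediate for the chain's consumers, who state it in their own block vocabulary).
WHY (cell context).  In the one-step improvement of the (3.130) transfer `G̃ = G₀ − G₀Δ′_πG̃` (`Δ′_π = π†Δπ − Δ = −(Δ∘D_U)∘P − P†∘(D*_U∘Δ)∘π`, `P = G′_kR_kD*_U`) every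
coefficient is a landed one-sided letter times ONE factor `Δ∘D_U` or its transpose; the OWNER's erratum E-2 had priced `Δ∘D_U` at `η⁻¹` by bounding `D*D(D_Uλ)` and
`Δ′(D_Uλ)` separately — this file shows the price is `j₀` (plan v15; the pair bootstrap (K71) `letter_bootstrap_pair` then closes the value and divergence rows of
`G̃_k` height-free).  HONEST SCOPE.  An exact finite-lattice identity and its triangle-inequality letter; `hJ` is a HYPOTHESIS of printed shape ((3.36) ⟹ `j₀ =
O(1)Mα₀(L^jη)⁻³` is `B9Eq336CurrentBound`'s, pv27 vocabulary, not repeated); the identity is stated AT `c₀ = η^d` — for `c₀ ≠ η^d` the chain's `hessOp` is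
`D*D + (η^d∕c₀)Δ′`, not a multiple of print's Hessian, and keeps an `η⁻¹`-size piece on gauge modes (recorded, not used); nothing of [B9] (3.36), (3.130)–(3.133),
Thm 3.3∕3.12∕3.13 or [B11] (117) is asserted, valued or discharged; «NE9 ⇐ the named binders»; NE9 NOT PRINTED ∕ NOT PROVED; row WALLED ON A MODEL (O-NE9-1;
#5 UNRULED); spine PROVED 0∕9; rung (B)+1 on a finite T⁴ — NOT infinite volume, NOT mass gap, NOT BetaPertH, NOT Clay.  HONEST DEPENDENCY: continuum YM on T⁴ ⇐
BetaPertH ∧ nine spine estimates (0/9 proved); BetaPertH ⇐ (D1) ∧ (D4) ∧ CAP+tail; G-an2-4 gates asym, D1 and NE2/3/4.  NEW file importing three BUILT modules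
(`B9Eq3117Polarized`, `B9Eq310DeltaPrimeJunction`, `B9Eq3119DeltaPiCarrier`); nothing modified.  Net new unproved facts: 0.
-/

noncomputable section

set_option autoImplicit false

open scoped InnerProductSpace ComplexConjugate BigOperators
open Complex

namespace Literature.MathematicalPhysics.QuantumFieldTheory.Balaban1983to89.B9Eq3117HessOpGaugeMode

open B9SectCLatticeCarrier (Bond DirPair shift)
open B4Sect5Torus (TSite)
open B9Eq311L2Pairing (WL2)
open B9Eq33CovDerivVector (shiftEquiv adTransport adTransport_apply covDeriv_apply_dir)
open B11Eq103H1Complex (BondL2K SiteL2K covDerivL2K equiv_covDerivL2K)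
open B9Eq310DeltaPrime (curlAt curvForm curvForm_symm hessForm hessForm_apply)
open B9Eq310HessianOperator (toAlg adTransportW adTransportW_apply PlaqL2K covCurlL2K equiv_covCurlL2K adjoint_covCurlL2K
  principalOpK principalOpK_eq_comp curvOp inner_curvOp hessOp hessOp_apply)
open B9Eq311TracePairing (starW equiv_starW apply_equiv_starW starW_starW tpair tpair_def tpair_comm tpair_add_right
  tpair_eq_inner_starW inner_eq_tpair_starW)
open B9Eq3119DeltaPiCarrier (apply_equiv_covCurlL2K toAlg_starW covCurlL2K_starW)
open B9Eq310HessianHermitian (adTransportW_adjoint)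
open B9Eq310DeltaPrimeJunction (hessForm_self_eq_hessPair)
open Beta.BackgroundVertices (ad)

/-! ## §1 The Hessian form is symmetric; the polar Hessian junction -/

section Form

variable {d : ℕ} {Pd : Fin d → ℕ} {𝔸 : Type*} [NormedRing 𝔸] [NormedAlgebra ℂ 𝔸]

/-- **The Hessian form (3.10) is symmetric** for a tracial `τ` (principal block `τ((DA)(p)(DB)(p))` by traciality, curvature block by
`B9Eq310DeltaPrime.curvForm_symm`). [folklore] [cite: Balaban1985BackgroundPropagators, (3.10) p.392] -/
theorem hessForm_symm (τ : 𝔸 →ₗ[ℂ] ℂ) (hτ : ∀ a b : 𝔸, τ (a * b) = τ (b * a)) (η : ℝ) (U : Bond d Pd → 𝔸ˣ)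
    (A B : Bond d Pd → 𝔸) : hessForm τ η U A B = hessForm τ η U B A := by
  rw [hessForm_apply, hessForm_apply, curvForm_symm]
  congr 1
  exact Finset.sum_congr rfl fun p _ => by rw [hτ]

/-- **THE POLAR HESSIAN JUNCTION (tracial `τ`)**: `B9Eq310DeltaPrime.hessForm τ η U A B` IS pv27's operator pairing `⟨Â, ΔB̂⟩ =
bondPair η d τ Â (deltaOp T U η B̂)` through the dictionary `T μ := shiftEquiv μ`, `U μ x := U (x, μ)`, `Â μ x := A (x, μ)` — from the diagonal junction
`B9Eq310DeltaPrimeJunction.hessForm_self_eq_hessPair` at `A + B`, `hessForm_symm` and `B9Eq310Hermitian.hessPair_add` (`2 ≠ 0` in `ℂ`). [folklore]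
[cite: Balaban1985BackgroundPropagators, (3.10) p.392, (3.12) p.392] -/
theorem hessForm_eq_bondPair_deltaOp (τ : 𝔸 →ₗ[ℂ] ℂ) (hτ : ∀ a b : 𝔸, τ (a * b) = τ (b * a)) (η : ℝ)
    (U : Bond d Pd → 𝔸ˣ) (A B : Bond d Pd → 𝔸) :
    hessForm τ η U A B =
      B9Eq39Adjoint.bondPair η d τ (fun μ y => A (y, μ))
        (B9Eq310Hermitian.deltaOp (fun μ => shiftEquiv μ) (fun μ y => U (y, μ)) η (fun μ y => B (y, μ))) := by
  have h := hessForm_self_eq_hessPair τ hτ η U (A + B)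
  simp only [map_add, LinearMap.add_apply] at h
  rw [hessForm_self_eq_hessPair τ hτ, hessForm_self_eq_hessPair τ hτ, hessForm_symm τ hτ η U B A,
    show (fun (μ : Fin d) (y : TSite d Pd) => (A + B) (y, μ)) = (fun μ y => A (y, μ)) + (fun μ y => B (y, μ)) from rfl,
    B9Eq310Hermitian.hessPair_add (fun μ => shiftEquiv μ) (fun μ y => U (y, μ)) τ hτ] at h
  have h2 : (2 : ℂ) * hessForm τ η U A B =
      2 * B9Eq39Adjoint.bondPair η d τ (fun μ y => A (y, μ))
        (B9Eq310Hermitian.deltaOp (fun μ => shiftEquiv μ) (fun μ y => U (y, μ)) η (fun μ y => B (y, μ))) := by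
    linear_combination h
  exact mul_left_cancel₀ two_ne_zero h2

end Form

/-! ## §2 The dictionary for the covariant gradient of a site function -/

section Dictionary

variable {d : ℕ} {Pd : Fin d → ℕ} {𝔸 : Type*} [Ring 𝔸] [Algebra ℂ 𝔸] {W : Type*} [NormedAddCommGroup W] [InnerProductSpace ℂ W]
  (φ : W ≃ₗ[ℂ] 𝔸) {c₀ : ℝ} [Fact (0 < c₀)] (η : ℝ) (U : Bond d Pd → 𝔸ˣ)

/-- **The dictionary for the covariant gradient (3.3) of a SITE function**: read in the algebra along `φ`, the chain's `covDerivL2K ℂ c₀ η⁻¹ (adTransportW φ U) l`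
at the bond `(x, μ)` IS pv27's `B9Eq3117Current.covDη T U η (φ ∘ l) μ x` = `η⁻¹(R(U(x,μ))λ(x + e_μ) − λ(x))` with `R(U)X = UXU⁻¹`. [folklore]
[cite: Balaban1985BackgroundPropagators, (3.3) pp.390–391] -/
theorem toAlg_covDerivL2K (l : SiteL2K ℂ d Pd c₀ W) (x : TSite d Pd) (μ : Fin d) :
    toAlg φ (covDerivL2K ℂ c₀ ((η : ℂ))⁻¹ (adTransportW φ U) l) (x, μ) =
      B9Eq3117Current.covDη (fun μ => shiftEquiv μ) (fun μ y => U (y, μ)) η (fun y => φ (WL2.equiv ℂ _ W l y)) μ x := by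
  rw [B9Eq3117Current.covDη_apply]
  change φ (WL2.equiv ℂ _ W (covDerivL2K ℂ c₀ ((η : ℂ))⁻¹ (adTransportW φ U) l) (x, μ)) = _
  rw [equiv_covDerivL2K, covDeriv_apply_dir, map_smul, map_sub, adTransportW_apply, LinearEquiv.apply_symm_apply]
  simp only [B9Eq39Adjoint.covD, B9Eq39Adjoint.R_def, shiftEquiv, Equiv.coe_fn_mk]

end Dictionary

/-! ## §3 The bilinear trace pairing of the Hessian operator IS the Hessian form (unitary background, `*`-trace norming, `c₀ = η^d`) -/

section Pairing

variable {d : ℕ} {Pd : Fin d → ℕ} {𝔸 : Type*} [NormedRing 𝔸] [NormedAlgebra ℂ 𝔸] [StarRing 𝔸] [StarModule ℂ 𝔸]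
  {W : Type*} [NormedAddCommGroup W] [InnerProductSpace ℂ W] [FiniteDimensional ℂ W] (φ : W ≃ₗ[ℂ] 𝔸) {c₀ : ℝ} [Fact (0 < c₀)]
  (τ : 𝔸 →ₗ[ℂ] ℂ) (hτ₂ : ∀ X Y : 𝔸, τ (X * Y) = τ (Y * X))
  (hφ : ∀ X Y : 𝔸, ⟪φ.symm X, φ.symm Y⟫_ℂ = τ (star X * Y)) (η : ℝ) {U : Bond d Pd → 𝔸ˣ} (hU : ∀ b, star (U b : 𝔸) = ((U b)⁻¹ : 𝔸ˣ))

include hτ₂ hφ hU in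
/-- **The bilinear trace pairing of the principal part**: `(x, D*Dy) = Σ_p c₀ τ((D_U x̃)(p)(D_U ỹ)(p))` — adjointness of (3.9)∕(3.4) on the `L²` spaces
(`adjoint_covCurlL2K`, transporters mutually adjoint by `adTransportW_adjoint` at a unitary background), reality of the curl (`covCurlL2K_starW`), and the
algebra-valued reading of the curl (`apply_equiv_covCurlL2K`). [folklore] [cite: Balaban1985BackgroundPropagators, (3.10) p.392, (3.9) p.392] -/
theorem tpair_principalOpK_eq (x y : BondL2K ℂ d Pd c₀ W) :
    tpair φ τ x (principalOpK φ η U y) =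
      ∑ p : B9SectCLatticeCarrier.Plaq d Pd, (c₀ : ℂ) * τ (curlAt ((η : ℂ))⁻¹ U p (toAlg φ x) * curlAt ((η : ℂ))⁻¹ U p (toAlg φ y)) := by
  have hc : conj (((η : ℂ))⁻¹) = ((η : ℂ))⁻¹ := by rw [map_inv₀, Complex.conj_ofReal]
  have hRS := adTransportW_adjoint φ τ hτ₂ hU hφ
  rw [tpair_eq_inner_starW φ τ hφ, principalOpK_eq_comp, LinearMap.comp_apply, ← adjoint_covCurlL2K _ hc _ _ hRS,
    LinearMap.adjoint_inner_right, covCurlL2K_starW φ η hU, ← tpair_eq_inner_starW φ τ hφ, tpair_def]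
  refine Finset.sum_congr rfl fun p _ => ?_
  rw [apply_equiv_covCurlL2K, apply_equiv_covCurlL2K]

include hφ in
/-- **The bilinear trace pairing of the curvature part**: `(x, Δ′y) = curvForm τ η U x̃ ỹ` (the `star` of `inner_curvOp` cancels against `x⋆`). [folklore]
[cite: Balaban1985BackgroundPropagators, (3.10) p.392] -/
theorem tpair_curvOp_eq (x y : BondL2K ℂ d Pd c₀ W) :
    tpair φ τ x (curvOp φ τ η U y) = curvForm τ η U (toAlg φ x) (toAlg φ y) := by
  rw [tpair_eq_inner_starW φ τ hφ, inner_curvOp, toAlg_starW, star_star]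

include hτ₂ hφ hU in
/-- **AT PRINT's WEIGHT `c₀ = η^d` THE BILINEAR FORM OF THE HESSIAN OPERATOR IS THE HESSIAN FORM (3.10)**: `tpair φ τ x (hessOp φ η U τ y) =
hessForm τ η U (toAlg φ x) (toAlg φ y)` — the principal block is weighted by `c₀` (through the plaquette `L²` product), the curvature block by the `η^d` built
into `curvForm` (its Riesz representative against the `c₀`-product); they carry the same weight exactly when `c₀ = η^d`, the weight of (3.11). [folklore]
[cite: Balaban1985BackgroundPropagators, (3.10)–(3.11) p.392] -/
theorem tpair_hessOp_eq (hc₀ : c₀ = η ^ d) (x y : BondL2K ℂ d Pd c₀ W) :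
    tpair φ τ x (hessOp φ η U τ y) = hessForm τ η U (toAlg φ x) (toAlg φ y) := by
  rw [hessOp_apply, tpair_add_right, tpair_principalOpK_eq φ τ hτ₂ hφ η hU, tpair_curvOp_eq φ τ hφ, hessForm_apply, hc₀]
  push_cast
  ring

end Pairing

/-! ## §4 (3.117) in operator form: the Hessian of a pure gauge mode IS the current commutator -/

section GaugeMode

variable {d : ℕ} {Pd : Fin d → ℕ} {𝔸 : Type*} [NormedRing 𝔸] [NormedAlgebra ℂ 𝔸] [StarRing 𝔸] [StarModule ℂ 𝔸]
  {W : Type*} [NormedAddCommGroup W] [InnerProductSpace ℂ W] [FiniteDimensional ℂ W] (φ : W ≃ₗ[ℂ] 𝔸) {c₀ : ℝ} [Fact (0 < c₀)]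
  (τ : 𝔸 →ₗ[ℂ] ℂ) (hτ₂ : ∀ X Y : 𝔸, τ (X * Y) = τ (Y * X))
  (hφ : ∀ X Y : 𝔸, ⟪φ.symm X, φ.symm Y⟫_ℂ = τ (star X * Y)) {η : ℝ} (hη : η ≠ 0) {U : Bond d Pd → 𝔸ˣ}
  (hU : ∀ b, star (U b : 𝔸) = ((U b)⁻¹ : 𝔸ˣ)) (hc₀ : c₀ = η ^ d)

omit [NormedAlgebra ℂ 𝔸] [StarRing 𝔸] [StarModule ℂ 𝔸] in
/-- The trace bookkeeping behind the operator reading of (3.117): the printed bracket `i[λ(b₋), A(b)] − i[A(b), R_bλ(b₊)]` paired with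
`J(b)` is `A(b)` paired with `i[J(b), λ(b₋) + R_bλ(b₊)]` (traciality). [folklore] -/
private theorem trace_bracket {𝔸 : Type*} [Ring 𝔸] [Algebra ℂ 𝔸] (τ : 𝔸 →ₗ[ℂ] ℂ) (hτ₂ : ∀ X Y : 𝔸, τ (X * Y) = τ (Y * X))
    (A lam Rlam Jv : 𝔸) :
    τ ((I • ad lam A - I • ad A Rlam) * Jv) = τ (A * (I • (Jv * (lam + Rlam) - (lam + Rlam) * Jv))) := by
  have e1 : τ (lam * A * Jv) = τ (A * (Jv * lam)) := by rw [mul_assoc, hτ₂, mul_assoc]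
  have e2 : τ (Rlam * A * Jv) = τ (A * (Jv * Rlam)) := by rw [mul_assoc, hτ₂, mul_assoc]
  simp only [ad, smul_sub, sub_mul, smul_mul_assoc, mul_smul_comm, map_sub, map_smul, mul_add, add_mul, map_add, mul_sub,
    smul_eq_mul, smul_add, ← mul_assoc] at e1 e2 ⊢
  linear_combination I * e1 + I * e2

include hτ₂ hφ hη hU hc₀ in
/-- **(3.117) IN OPERATOR FORM — THE HESSIAN OF A PURE GAUGE MODE IS THE CURRENT COMMUTATOR.**  On the periodic `L²` bond carrier of
`B9Eq310HessianOperator` (fibre `W ≃ 𝔸`, norming `⟨φ⁻¹X, φ⁻¹Y⟩ = τ(X*Y)` with a tracial `τ`, unitary background `U(b)* = U(b)⁻¹`, print's weight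
`c₀ = η^d` of (3.11)), for EVERY site function `λ` and every bond `b = ⟨x, x + e_μ⟩`:
`(Δ^η(U) D^η_U λ)(b) = φ⁻¹( (i∕2)·[J(b), λ(x) + R(U(b))λ(x + e_μ)] )`, `J = D*η⁻²Im ∂U` the current of (3.11) (pv27's `B9Eq39Adjoint.J` through
the dictionary of `B9Eq310DeltaPrimeJunction`) — NO second difference, NO `η⁻¹`: the `curl†(F·λ)` part of `D*D(Dλ)` and the curvature part `Δ′(Dλ)`
recombine into the commutator with the DIVERGENCE of the field strength.  This is print's «almost invariance of the quadratic form, the error terms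
are small because the function J = D*η⁻²Im ∂U is small» (p. 419) read pointwise: `B9Eq3117Polarized.two_mul_bondPair_deltaOp_covDη` (the
`(A, λ)`-bilinear part of (3.117)) transported to the `L²` carrier through the polar Hessian junction and the non-degeneracy of the pairing.
[cite: Balaban1985BackgroundPropagators, (3.117) p.419, (3.120) p.419, (3.10)–(3.11) p.392] -/
theorem equiv_hessOp_covDerivL2K (l : SiteL2K ℂ d Pd c₀ W) (b : Bond d Pd) :
    WL2.equiv ℂ _ W (hessOp φ η U τ (covDerivL2K ℂ c₀ ((η : ℂ))⁻¹ (adTransportW φ U) l)) b =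
      φ.symm ((I / 2) •
        (B9Eq39Adjoint.J (fun μ => shiftEquiv μ) (fun μ y => U (y, μ)) η b.2 b.1 *
            (φ (WL2.equiv ℂ _ W l b.1) + (U b : 𝔸) * φ (WL2.equiv ℂ _ W l (shift b.2 b.1)) * ((U b)⁻¹ : 𝔸ˣ)) -
          (φ (WL2.equiv ℂ _ W l b.1) + (U b : 𝔸) * φ (WL2.equiv ℂ _ W l (shift b.2 b.1)) * ((U b)⁻¹ : 𝔸ˣ)) *
            B9Eq39Adjoint.J (fun μ => shiftEquiv μ) (fun μ y => U (y, μ)) η b.2 b.1)) := by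
  -- abbreviations (no definitions): the dictionary, the algebra-valued readings, the candidate element
  set T' : Fin d → Equiv.Perm (TSite d Pd) := fun μ => shiftEquiv μ with hT'
  set U' : Fin d → TSite d Pd → 𝔸ˣ := fun μ y => U (y, μ) with hU'
  set lam : TSite d Pd → 𝔸 := fun y => φ (WL2.equiv ℂ _ W l y) with hlam
  set Jf : Fin d → TSite d Pd → 𝔸 := B9Eq39Adjoint.J T' U' η with hJf
  set M : Bond d Pd → 𝔸 := fun b => lam b.1 + (U b : 𝔸) * lam (shift b.2 b.1) * ((U b)⁻¹ : 𝔸ˣ) with hM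
  set g : BondL2K ℂ d Pd c₀ W :=
    (WL2.equiv ℂ (fun _ : Bond d Pd => c₀) W).symm (fun b => φ.symm ((I / 2) • (Jf b.2 b.1 * M b - M b * Jf b.2 b.1))) with hg
  suffices h : hessOp φ η U τ (covDerivL2K ℂ c₀ ((η : ℂ))⁻¹ (adTransportW φ U) l) = g by
    rw [h]; rfl
  -- test against every `z`, through the bilinear trace pairing
  refine ext_inner_left ℂ fun z => ?_
  rw [inner_eq_tpair_starW φ τ hφ, inner_eq_tpair_starW φ τ hφ]
  set x : BondL2K ℂ d Pd c₀ W := starW φ z with hx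
  rw [tpair_hessOp_eq φ τ hτ₂ hφ η hU hc₀, hessForm_eq_bondPair_deltaOp τ hτ₂]
  have hD : (fun μ y => toAlg φ (covDerivL2K ℂ c₀ ((η : ℂ))⁻¹ (adTransportW φ U) l) (y, μ)) =
      B9Eq3117Current.covDη T' U' η lam := by
    funext μ y
    exact toAlg_covDerivL2K φ η U l y μ
  rw [hD]
  -- (3.117), (A, λ)-bilinear part, from `B9Eq3117Polarized`
  haveI : FiniteDimensional ℂ 𝔸 := LinearEquiv.finiteDimensional φ
  haveI : CompleteSpace 𝔸 := FiniteDimensional.complete ℂ 𝔸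
  have hT : ∀ μ ν y, T' μ (T' ν y) = T' ν (T' μ y) := fun μ ν y => B9Eq34CovCurlVector.shift_comm μ ν y
  have hτc : ∀ a b : 𝔸, LinearMap.toContinuousLinearMap τ (a * b) = LinearMap.toContinuousLinearMap τ (b * a) :=
    fun a b => hτ₂ a b
  have key := B9Eq3117Polarized.two_mul_bondPair_deltaOp_covDη T' U' hT (LinearMap.toContinuousLinearMap τ) hτc hη d
    (fun μ y => toAlg φ x (y, μ)) lam
  rw [LinearMap.coe_toContinuousLinearMap] at key
  have key' : B9Eq39Adjoint.bondPair η d τ (fun μ y => toAlg φ x (y, μ))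
        (B9Eq310Hermitian.deltaOp T' U' η (B9Eq3117Current.covDη T' U' η lam)) =
      2⁻¹ * B9Eq39Adjoint.bondPair η d τ
        (fun μ y => I • ad (lam y) (toAlg φ x (y, μ)) - I • ad (toAlg φ x (y, μ)) (B9Eq39Adjoint.R (U' μ y) (lam (T' μ y)))) Jf := by
    rw [hJf]
    linear_combination (2 : ℂ)⁻¹ * key
  rw [key', B9Eq39Adjoint.bondPair, tpair_def, Fintype.sum_prod_type, Finset.mul_sum, Finset.mul_sum]
  refine Finset.sum_congr rfl fun y _ => ?_
  rw [Finset.mul_sum, Finset.mul_sum]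
  refine Finset.sum_congr rfl fun μ _ => ?_
  rw [trace_bracket τ hτ₂]
  have hc : ((c₀ : ℝ) : ℂ) = ((η : ℂ)) ^ d := by rw [hc₀]; push_cast; ring
  rw [hc]
  have hgb : φ (WL2.equiv ℂ (fun _ : Bond d Pd => c₀) W g (y, μ)) = (I / 2) • (Jf μ y * M (y, μ) - M (y, μ) * Jf μ y) := by
    rw [hg]
    exact φ.apply_symm_apply _
  rw [hgb]
  have hMb : M (y, μ) = lam y + B9Eq39Adjoint.R (U' μ y) (lam (T' μ y)) := by
    simp only [hM, hU', hT', B9Eq39Adjoint.R_def]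
    rfl
  have ht : toAlg φ x (y, μ) = φ (WL2.equiv ℂ (fun _ : Bond d Pd => c₀) W x (y, μ)) := rfl
  rw [← hMb, ht, mul_smul_comm, mul_smul_comm, map_smul, map_smul, smul_eq_mul, smul_eq_mul]
  ring

end GaugeMode

/-! ## §5 «small because J is small»: the pointwise letter of `Δ^η(U)∘D^η_U` — order zero, no `η⁻¹`, range on the bonds touching `supp λ` -/

section Bound

open B7Prop1Explicit (U1 mem_U1)

variable {d : ℕ} {Pd : Fin d → ℕ} {𝔸 : Type*} [NormedRing 𝔸] [NormedAlgebra ℂ 𝔸] [NormOneClass 𝔸] [StarRing 𝔸] [StarModule ℂ 𝔸]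
  {W : Type*} [NormedAddCommGroup W] [InnerProductSpace ℂ W] [FiniteDimensional ℂ W] (φ : W ≃ₗ[ℂ] 𝔸) {c₀ : ℝ} [Fact (0 < c₀)]
  (τ : 𝔸 →ₗ[ℂ] ℂ) (hτ₂ : ∀ X Y : 𝔸, τ (X * Y) = τ (Y * X))
  (hφ : ∀ X Y : 𝔸, ⟪φ.symm X, φ.symm Y⟫_ℂ = τ (star X * Y)) {η : ℝ} (hη : η ≠ 0) {U : Bond d Pd → 𝔸ˣ}
  (hU : ∀ b, star (U b : 𝔸) = ((U b)⁻¹ : 𝔸ˣ)) (hc₀ : c₀ = η ^ d) (hUb : ∀ b, U b ∈ U1 𝔸)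
  {Mφ Mφ' j₀ : ℝ} (hMφ' : 0 ≤ Mφ') (hφn : ∀ w, ‖φ w‖ ≤ Mφ * ‖w‖) (hφ' : ∀ X, ‖φ.symm X‖ ≤ Mφ' * ‖X‖)
  (hJ : ∀ μ y, ‖B9Eq39Adjoint.J (fun μ => shiftEquiv μ) (fun μ y => U (y, μ)) η μ y‖ ≤ j₀)

include hτ₂ hφ hη hU hc₀ hUb hMφ' hφn hφ' hJ in
/-- **«THE ERROR TERMS ARE SMALL BECAUSE THE FUNCTION J IS SMALL» — THE POINTWISE LETTER OF `Δ^η(U)∘D^η_U`**: under the chain's norming letters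
(`‖φw‖ ≤ M_φ‖w‖`, `‖φ⁻¹X‖ ≤ M_φ′‖X‖`, `U(b) ∈ U1` so `‖U(b)‖, ‖U(b)⁻¹‖ ≤ 1`) and print's third window (3.36) in the shape `‖J(b)‖ ≤ j₀`:
`‖(Δ^η(U)D^η_Uλ)(b)‖ ≤ M_φ′·j₀·M_φ·(‖λ(b₋)‖ + ‖λ(b₊)‖)` — ORDER ZERO, no `η⁻¹`, no gradient of `λ` (the OWNER lineage's erratum E-2, which bounded `D*D(D_Uλ)` and
`Δ′(D_Uλ)` separately at the price `η⁻¹`, is superseded). [cite: Balaban1985BackgroundPropagators, (3.117) p.419, (3.36) p.396, p.421] -/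
theorem norm_equiv_hessOp_covDerivL2K_le (l : SiteL2K ℂ d Pd c₀ W) (b : Bond d Pd) :
    ‖WL2.equiv ℂ _ W (hessOp φ η U τ (covDerivL2K ℂ c₀ ((η : ℂ))⁻¹ (adTransportW φ U) l)) b‖ ≤
      Mφ' * j₀ * Mφ * (‖WL2.equiv ℂ _ W l b.1‖ + ‖WL2.equiv ℂ _ W l (shift b.2 b.1)‖) := by
  rw [equiv_hessOp_covDerivL2K φ τ hτ₂ hφ hη hU hc₀]
  set Jb := B9Eq39Adjoint.J (fun μ => shiftEquiv μ) (fun μ y => U (y, μ)) η b.2 b.1 with hJb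
  set l₀ := φ (WL2.equiv ℂ _ W l b.1) with hl₀
  set l₁ := φ (WL2.equiv ℂ _ W l (shift b.2 b.1)) with hl₁
  set M := l₀ + (U b : 𝔸) * l₁ * ((U b)⁻¹ : 𝔸ˣ) with hM
  have hU1 := mem_U1.1 (hUb b)
  have hj₀ : 0 ≤ j₀ := (norm_nonneg _).trans (hJ b.2 b.1)
  have hMle : ‖M‖ ≤ Mφ * (‖WL2.equiv ℂ _ W l b.1‖ + ‖WL2.equiv ℂ _ W l (shift b.2 b.1)‖) := by
    have h1 : ‖(U b : 𝔸) * l₁ * ((U b)⁻¹ : 𝔸ˣ)‖ ≤ ‖l₁‖ := by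
      calc ‖(U b : 𝔸) * l₁ * ((U b)⁻¹ : 𝔸ˣ)‖ ≤ ‖(U b : 𝔸)‖ * ‖l₁‖ * ‖(((U b)⁻¹ : 𝔸ˣ) : 𝔸)‖ :=
            (norm_mul_le _ _).trans (mul_le_mul_of_nonneg_right (norm_mul_le _ _) (norm_nonneg _))
        _ ≤ 1 * ‖l₁‖ * 1 := by gcongr; exacts [hU1.1, hU1.2]
        _ = ‖l₁‖ := by ring
    calc ‖M‖ ≤ ‖l₀‖ + ‖(U b : 𝔸) * l₁ * ((U b)⁻¹ : 𝔸ˣ)‖ := norm_add_le _ _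
      _ ≤ Mφ * ‖WL2.equiv ℂ _ W l b.1‖ + Mφ * ‖WL2.equiv ℂ _ W l (shift b.2 b.1)‖ := add_le_add (hφn _) (h1.trans (hφn _))
      _ = _ := by ring
  have hcomm : ‖Jb * M - M * Jb‖ ≤ 2 * (j₀ * ‖M‖) := by
    calc ‖Jb * M - M * Jb‖ ≤ ‖Jb * M‖ + ‖M * Jb‖ := norm_sub_le _ _
      _ ≤ ‖Jb‖ * ‖M‖ + ‖M‖ * ‖Jb‖ := add_le_add (norm_mul_le _ _) (norm_mul_le _ _)
      _ ≤ j₀ * ‖M‖ + ‖M‖ * j₀ := by gcongr <;> exact hJ b.2 b.1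
      _ = 2 * (j₀ * ‖M‖) := by ring
  have hI : ‖(I / 2 : ℂ)‖ = 2⁻¹ := by simp
  calc ‖φ.symm ((I / 2) • (Jb * M - M * Jb))‖ ≤ Mφ' * ‖(I / 2) • (Jb * M - M * Jb)‖ := hφ' _
    _ ≤ Mφ' * (2⁻¹ * (2 * (j₀ * ‖M‖))) := by
        refine mul_le_mul_of_nonneg_left ?_ hMφ'
        rw [norm_smul, hI]
        exact mul_le_mul_of_nonneg_left hcomm (by norm_num)
    _ = Mφ' * j₀ * ‖M‖ := by ring
    _ ≤ Mφ' * j₀ * (Mφ * (‖WL2.equiv ℂ _ W l b.1‖ + ‖WL2.equiv ℂ _ W l (shift b.2 b.1)‖)) :=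
        mul_le_mul_of_nonneg_left hMle (mul_nonneg hMφ' hj₀)
    _ = _ := by ring

include hτ₂ hφ hη hU hc₀ hUb hMφ' hφn hφ' hJ in
/-- **The sup letter**: `‖λ‖_∞ ≤ N` ⟹ `‖(Δ^η(U)D^η_Uλ)(b)‖ ≤ 2M_φM_φ′j₀·N` at every bond. [cite: Balaban1985BackgroundPropagators, (3.117) p.419, (3.36) p.396] -/
theorem norm_equiv_hessOp_covDerivL2K_le_sup (hMφ : 0 ≤ Mφ) (l : SiteL2K ℂ d Pd c₀ W) {N : ℝ}
    (hN : ∀ y, ‖WL2.equiv ℂ _ W l y‖ ≤ N) (b : Bond d Pd) :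
    ‖WL2.equiv ℂ _ W (hessOp φ η U τ (covDerivL2K ℂ c₀ ((η : ℂ))⁻¹ (adTransportW φ U) l)) b‖ ≤ 2 * Mφ * Mφ' * j₀ * N := by
  have hj₀ : 0 ≤ j₀ := (norm_nonneg _).trans (hJ b.2 b.1)
  refine (norm_equiv_hessOp_covDerivL2K_le φ τ hτ₂ hφ hη hU hc₀ hUb hMφ' hφn hφ' hJ l b).trans ?_
  have h2 : ‖WL2.equiv ℂ _ W l b.1‖ + ‖WL2.equiv ℂ _ W l (shift b.2 b.1)‖ ≤ N + N := add_le_add (hN _) (hN _)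
  calc Mφ' * j₀ * Mφ * (‖WL2.equiv ℂ _ W l b.1‖ + ‖WL2.equiv ℂ _ W l (shift b.2 b.1)‖) ≤ Mφ' * j₀ * Mφ * (N + N) :=
        mul_le_mul_of_nonneg_left h2 (mul_nonneg (mul_nonneg hMφ' hj₀) hMφ)
    _ = 2 * Mφ * Mφ' * j₀ * N := by ring

include hτ₂ hφ hη hU hc₀ in
omit [NormOneClass 𝔸] in
/-- **LOCALITY — a one-step stencil**: `(Δ^η(U)D^η_Uλ)(b)` vanishes unless `λ(b₋) ≠ 0` or `λ(b₊) ≠ 0` (the range of `Δ∘D_U` on `λ` supported in a block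
is the set of bonds touching the block). [cite: Balaban1985BackgroundPropagators, (3.117) p.419] -/
theorem equiv_hessOp_covDerivL2K_eq_zero (l : SiteL2K ℂ d Pd c₀ W) (b : Bond d Pd) (h₀ : WL2.equiv ℂ _ W l b.1 = 0)
    (h₁ : WL2.equiv ℂ _ W l (shift b.2 b.1) = 0) :
    WL2.equiv ℂ _ W (hessOp φ η U τ (covDerivL2K ℂ c₀ ((η : ℂ))⁻¹ (adTransportW φ U) l)) b = 0 := by
  rw [equiv_hessOp_covDerivL2K φ τ hτ₂ hφ hη hU hc₀, h₀, h₁, map_zero, mul_zero, zero_mul, add_zero, mul_zero, zero_mul, sub_zero,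
    smul_zero, map_zero]

end Bound

end Literature.MathematicalPhysics.QuantumFieldTheory.Balaban1983to89.B9Eq3117HessOpGaugeMode
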